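import Literature.MathematicalPhysics.QuantumFieldTheory.Balaban1983to89.Beta.BalabanCompositeJets
import Summits.QuantumFields.BalabanUV.Beta.GAN24.WilsonVertexSumZero
import Summits.QuantumFields.BalabanUV.Beta.GAN24.KernelLegCharges

/-!
# `BalabanUV.Beta.GAN24.CompositeStencilChargeZero` — row G-an2-4 ∕ (CONV-C), W-slot, SKELETON-W3 v0.2 §7.2 sum rule (S3c), PART 1b:
# THE FIELD–FIELD BLOCK OF THE COMPOSITE FINE STENCIL `Sc n κ u` HAS VANISHING TOTAL OVER ITS TWO KERNEL LEGS, AT EVERY LEVEL `n`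

NOT IN PRINT; OUR PROOF ATTEMPT (idle-seat one-shot kernel lemma under the row owner's RULINGS-13 invitation «W3-S3C*», unit
`b2b-balaban-gan24-formalise-leaf-06`, gen 8).  HONEST FRAMING (cell contract, verbatim): «discharging `BetaPertH` makes Bałaban's UV stability
UNCONDITIONAL — a real constructive-QFT result; it is NOT the continuum limit and NOT the Clay problem.»  HONEST DEPENDENCY (verbatim):
«continuum YM on T⁴ ⇐ BetaPertH ∧ nine spine estimates (0/9 proved); BetaPertH ⇐ (D1) ∧ (D4) ∧ CAP+tail; G-an2-4 gates asym, D1 and NE2/3/4.»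

WHAT ([folklore] Fubini over absolutely convergent lattice sums; generic `d`, `Lc ≥ 1`, all binder constants `cE cVH cΛ`; 0 `def`, 0 cite,
0 sorry).  For an4∕BCJ's COMPOSITE FINE STENCIL `BalabanCompositeJets.Sc d Lc cE cVH cΛ n κ u` (the first `B`-jet table of the `(n+1)`-fold
composite system in fine coordinates) the `(inl α, inl β)` entries, summed over BOTH kernel legs `(x, z) ∈ ℤ^{d+1} × ℤ^{d+1}`, vanish for every
level `n`, fine bond `(κ, u)` and directions `α, β` (`hasSum_Sc_inl_inl`, `tsum_Sc_inl_inl`, `tsum_tsum_Sc_inl_inl`):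
* level `0` (`BalabanStepJets.S0`): the Wilson piece by leaf-15's W1 `WilsonVertexSumZero.wilsonA_tsum_zero` (BY NAME); the (V-H) border
  `mfNeg (vhS …)` has no field–field block (`packVH`); the Lagrange piece `SLam Lc (lamCoeffOf (KInv Lc) Lc) hessFF`: the field–field total of
  an1's `hessFF Lc μ y` is `y`-free (`hessFF_translate`), so the piece totals `Σ_μ T_μ · Σ'_y lamCoeffOf (KInv Lc) Lc μ y κ u = 0`
  (`KernelLegCharges.hasSum_lamCoeffOf_KInv`: (Q-lin) for the multiplier–field row + the flat Hessian column kills constants);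
* level `n → n+1` (`Sc_succ`): `pushSum_inl_inl` (the push leaves the field–field block untouched), the border increment `borderInc` has no
  field–field block, and the Lagrange increment `lagrInc` is the level-`0` mechanism at blocking `Lc^{n+2}` (`avgLift_shiftK` makes the
  field–field total of `avgLift (Lc^{n+1}) (hessFF Lc μ y)` `y`-free).
§8 (for PART 2, `GAN24/ValueJetChargeZero`): the chain-rule vertex `OneStepResolventKernel.vertexOf S μ y` of ANY local stencil family with
vanishing field–field totals has vanishing field–field totals (`hasSum_vertexOf_inl_inl`); instance `hasSum_vertexOf_Sc_inl_inl`.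
READING (docstring level, asserted nowhere): this is the «first field table on two constant field legs vanishes» input (S3c) of the W-slot's
zero-mode calculus one chain-rule down — it asserts NO shape of Bałaban's tables, pins no colour constant, discharges NOTHING of
«T2Shape»∕(hW, hWall).  NOT «W-slot closed», NEVER «G-an2-4 closed»; NOT BetaPertH, NOT continuum, NOT Clay.
-/

noncomputable section

open Finset
open scoped BigOperators
open Literature.MathematicalPhysics.QuantumFieldTheory
open Literature.MathematicalPhysics.QuantumFieldTheory.Balaban1983to89
open Literature.MathematicalPhysics.QuantumFieldTheory.Balaban1983to89.Beta
open B12Sec2to5 (l1 l1_nonneg Decay510)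
open ExpKernelCalculus (Site MKer BiLoc Decays VertexFamily shiftK)
open KernelSpecInstance (wH decay_wH)
open OneStepResolventKernel (Fib LocStencil KInv wsum vertexOf decays_KInv)
open InterLevelTransport (cwsum cwsum_apply SLam avgLift avgLift_shiftK biLoc_avgLift)
open StepJetData (wilsonA mfNeg mfNeg_inl_inl locStencil_wilsonA)
open AveragingHessianKernels (vhS hessFF packVH_inl_inl hessFF_translate biLoc_hessFF)
open BalabanStepJets (lamCoeffOf abs_lamCoeffOf_le S0)
open BalabanCompositeJets (pushSum pushSum_inl_inl borderInc lagrInc Sc Sc_zero Sc_succ locStencil_Sc)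
open Summit.QuantumFields.BalabanUV.Beta.GAN24.WilsonVertexSumZero (wilsonA_tsum_zero)
open Summit.QuantumFields.BalabanUV.Beta.GAN24.KernelLegCharges

namespace Summit.QuantumFields.BalabanUV.Beta.GAN24.CompositeStencilChargeZero

variable {d : ℕ}

/-! ## §5 The Lagrange stencil `SLam` has zero field–field total whenever its coefficients sum to zero over the coarse bond position -/

section Lagrange

variable {N : ℕ} [NeZero N]

/-- [folklore] **`SLam N c Q2 κ′ u` HAS ZERO FIELD–FIELD DOUBLE-LEG SUM** when, for each direction `μ`, the coefficients `y ↦ c μ y κ′ u` sum to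
zero (and decay from `u` at the coarse scale) and the curvature kernels `Q2 μ y` (a vertex family) all have the same field–field double-leg
sum as `Q2 μ 0`. -/
theorem hasSum_SLam_inl_inl {c : Fin (d + 1) → Site (d + 1) → Fin (d + 1) → Site (d + 1) → ℝ}
    {Q2 : Fin (d + 1) → Site (d + 1) → MKer (d + 1) (Fib d)} {C δ Cq δq : ℝ} (κ' : Fin (d + 1)) (u : Site (d + 1))
    (hc : ∀ μ y, |c μ y κ' u| ≤ C * Real.exp (-δ * l1 ((N : ℤ) • y - u))) (hδ : 0 < δ) (hQ : VertexFamily Q2 N Cq δq)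
    (hδq : 0 < δq) (hc0 : ∀ μ, HasSum (fun y => c μ y κ' u) 0) (α β : Fin (d + 1))
    (hT : ∀ μ y, ∑' xz : Site (d + 1) × Site (d + 1), Q2 μ y xz.1 xz.2 (Sum.inl α) (Sum.inl β)
      = ∑' xz : Site (d + 1) × Site (d + 1), Q2 μ 0 xz.1 xz.2 (Sum.inl α) (Sum.inl β)) :
    HasSum (fun xz : Site (d + 1) × Site (d + 1) => SLam N c Q2 κ' u xz.1 xz.2 (Sum.inl α) (Sum.inl β)) 0 := by
  have hN : 1 ≤ N := Nat.one_le_iff_ne_zero.2 (NeZero.ne N)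
  have hμ : ∀ μ : Fin (d + 1), HasSum (fun xz : Site (d + 1) × Site (d + 1) =>
      cwsum N (fun y => c μ y κ' u) (Q2 μ) xz.1 xz.2 (Sum.inl α) (Sum.inl β)) 0 := by
    intro μ
    have h := hasSum_prod_wsum_of_weights hN (hc μ) hδ (hQ μ) hδq (Sum.inl α) (Sum.inl β) (hc0 μ) (hT μ)
    refine h.congr_fun fun xz => ?_
    exact cwsum_apply _ _ _ _ _ _
  have h := (hasSum_sum fun μ (_ : μ ∈ (Finset.univ : Finset (Fin (d + 1)))) => hμ μ).neg
  simp only [Finset.sum_const_zero, neg_zero] at h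
  refine h.congr_fun fun xz => ?_
  simp only [SLam]

/-- [folklore] an1's constraint Hessian `hessFF Lc μ y` is a simultaneous-shift copy of `hessFF Lc μ 0`, so its field–field total is `y`-free. -/
theorem tsum_prod_hessFF_eq (Lc : ℕ) (μ : Fin (d + 1)) (y : Site (d + 1)) (a b : Fib d) :
    ∑' xz : Site (d + 1) × Site (d + 1), hessFF Lc μ y xz.1 xz.2 a b = ∑' xz : Site (d + 1) × Site (d + 1), hessFF Lc μ 0 xz.1 xz.2 a b := by
  have h : hessFF (d := d) Lc μ y = shiftK (-((Lc : ℤ) • y)) (hessFF Lc μ 0) := by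
    have := hessFF_translate (d := d) (L := Lc) μ 0 y
    rwa [zero_add] at this
  rw [h, tsum_prod_shiftK]

/-- [folklore] … and so is its averaging lift `avgLift M (hessFF Lc μ y)` (`avgLift_shiftK`). -/
theorem tsum_prod_avgLift_hessFF_eq (Lc M : ℕ) [NeZero M] (μ : Fin (d + 1)) (y : Site (d + 1)) (a b : Fib d) :
    ∑' xz : Site (d + 1) × Site (d + 1), avgLift M (hessFF Lc μ y) xz.1 xz.2 a b
      = ∑' xz : Site (d + 1) × Site (d + 1), avgLift M (hessFF Lc μ 0) xz.1 xz.2 a b := by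
  have h : hessFF (d := d) Lc μ y = shiftK (-((Lc : ℤ) • y)) (hessFF Lc μ 0) := by
    have := hessFF_translate (d := d) (L := Lc) μ 0 y
    rwa [zero_add] at this
  rw [h, avgLift_shiftK, tsum_prod_shiftK]

/-- [folklore] **THE `j = 0` LAGRANGE STENCIL `S^Λ = SLam Lc (lamCoeffOf (KInv Lc) Lc) hessFF` HAS ZERO FIELD–FIELD TOTAL.** -/
theorem hasSum_SLam_KInv_hessFF (Lc : ℕ) [NeZero Lc] (hLc : 1 ≤ Lc) (κ' : Fin (d + 1)) (u : Site (d + 1)) (α β : Fin (d + 1)) :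
    HasSum (fun xz : Site (d + 1) × Site (d + 1) =>
      SLam Lc (lamCoeffOf (KInv (N := Lc) (d := d)) Lc) (fun μ y => hessFF Lc μ y) κ' u xz.1 xz.2 (Sum.inl α) (Sum.inl β)) 0 := by
  obtain ⟨δ₀, C, hδ₀, hC, hdec⟩ := decays_KInv (N := Lc) (d := d)
  have hc := abs_lamCoeffOf_le (N := Lc) hdec hC hδ₀.le
  have hQ : VertexFamily (fun μ y => hessFF (d := d) Lc μ y) Lc (2 * (AveragingHessianKernels.ell (d + 1) Lc : ℝ) ^ 2 *
      Real.exp (4 * ((d : ℝ) + 1) * Lc * 1)) 1 := fun μ y => biLoc_hessFF hLc μ y zero_le_one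
  exact hasSum_SLam_inl_inl κ' u (fun μ y => hc μ y κ' u) hδ₀ hQ one_pos (fun μ => hasSum_lamCoeffOf_KInv μ κ' u) α β
    (fun μ y => tsum_prod_hessFF_eq Lc μ y _ _)

/-- [folklore] **THE LAGRANGE INCREMENT `lagrInc Lc M N′` (`N′ = M·Lc`) HAS ZERO FIELD–FIELD TOTAL.** -/
theorem hasSum_lagrInc_inl_inl (Lc M N' : ℕ) [NeZero M] [NeZero N'] (hLc : 1 ≤ Lc) (hN : N' = M * Lc) (κ : Fin (d + 1))
    (u : Site (d + 1)) (α β : Fin (d + 1)) :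
    HasSum (fun xz : Site (d + 1) × Site (d + 1) => lagrInc d Lc M N' κ u xz.1 xz.2 (Sum.inl α) (Sum.inl β)) 0 := by
  obtain ⟨δ₀, C, hδ₀, hC, hdec⟩ := decays_KInv (N := N') (d := d)
  have hM0 : (M : ℝ) ≠ 0 := by exact_mod_cast NeZero.ne M
  have hMδ : 0 ≤ (M : ℝ) * δ₀ := mul_nonneg (Nat.cast_nonneg M) hδ₀.le
  have hc := abs_lamCoeffOf_le (N := N') hdec hC hδ₀.le
  have hQ : VertexFamily (fun μ y => avgLift M (hessFF (d := d) Lc μ y)) N'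
      (2 * (AveragingHessianKernels.ell (d + 1) Lc : ℝ) ^ 2 * Real.exp (4 * ((d : ℝ) + 1) * Lc * (M * δ₀)) *
        Real.exp (4 * (d + 1) * (M * δ₀))) δ₀ := by
    intro μ y
    have hA := biLoc_avgLift M (biLoc_hessFF hLc μ y hMδ) hMδ
    rw [mul_div_cancel_left₀ δ₀ hM0, ← mul_smul, ← Nat.cast_mul, ← hN] at hA
    exact hA
  unfold lagrInc
  exact hasSum_SLam_inl_inl κ u (fun μ y => hc μ y κ u) hδ₀ hQ hδ₀ (fun μ => hasSum_lamCoeffOf_KInv μ κ u) α β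
    (fun μ y => tsum_prod_avgLift_hessFF_eq Lc M μ y _ _)

end Lagrange

/-! ## §6 The border pieces have no field–field block -/

/-- [folklore] The (V-H) border `mfNeg (vhS …)` has no field–field entries. -/
theorem mfNeg_vhS_inl_inl (Lc : ℕ) (κ' : Fin (d + 1)) (u x z : Site (d + 1)) (α β : Fin (d + 1)) :
    mfNeg (vhS d Lc κ' u) x z (Sum.inl α) (Sum.inl β) = 0 := by
  rw [mfNeg_inl_inl]
  unfold vhS
  exact packVH_inl_inl _ _ _ _ _ _ _ _

/-- [folklore] The averaging lift of a kernel without field–field entries has none. -/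
theorem avgLift_inl_inl_eq_zero (M : ℕ) {G : MKer (d + 1) (Fib d)} {α β : Fin (d + 1)}
    (hG : ∀ x z, G x z (Sum.inl α) (Sum.inl β) = 0) (x w : Site (d + 1)) : avgLift M G x w (Sum.inl α) (Sum.inl β) = 0 := by
  unfold avgLift
  refine Finset.sum_eq_zero fun i _ => Finset.sum_eq_zero fun i' _ => ?_
  rw [hG, ite_self, mul_zero]

/-- [folklore] The border increment `borderInc` has no field–field entries. -/
theorem borderInc_inl_inl (Lc M : ℕ) [NeZero M] (κ : Fin (d + 1)) (u x w : Site (d + 1)) (α β : Fin (d + 1)) :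
    borderInc d Lc M κ u x w (Sum.inl α) (Sum.inl β) = 0 := by
  unfold borderInc
  exact Finset.sum_eq_zero fun s _ => avgLift_inl_inl_eq_zero M (fun x z => mfNeg_vhS_inl_inl Lc κ _ x z α β) x w

/-! ## §7 THE THEOREM: every composite stencil `Sc n κ u` has zero field–field double-leg sum -/

section Main

variable {Lc : ℕ} [NeZero Lc]

/-- [folklore] Level `0`: Bałaban's `j = 0` stencil `S₀` has zero field–field double-leg sum (W1 + no border block + the Lagrange mechanism). -/
theorem hasSum_S0_inl_inl (hLc : 1 ≤ Lc) (cE cVH cΛ : ℝ) (κ' : Fin (d + 1)) (u : Site (d + 1)) (α β : Fin (d + 1)) :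
    HasSum (fun xz : Site (d + 1) × Site (d + 1) => S0 d Lc cE cVH cΛ κ' u xz.1 xz.2 (Sum.inl α) (Sum.inl β)) 0 := by
  have hW : HasSum (fun xz : Site (d + 1) × Site (d + 1) => wilsonA d κ' u xz.1 xz.2 (Sum.inl α) (Sum.inl β)) 0 :=
    hasSum_prod_of_biLoc_of_tsum (locStencil_wilsonA (d := d) zero_le_one κ' u) one_pos _ _ (wilsonA_tsum_zero κ' u α β)
  have hB : HasSum (fun xz : Site (d + 1) × Site (d + 1) => mfNeg (vhS d Lc κ' u) xz.1 xz.2 (Sum.inl α) (Sum.inl β)) 0 := by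
    have e : (fun xz : Site (d + 1) × Site (d + 1) => mfNeg (vhS d Lc κ' u) xz.1 xz.2 (Sum.inl α) (Sum.inl β)) = fun _ => 0 :=
      funext fun xz => mfNeg_vhS_inl_inl Lc κ' u xz.1 xz.2 α β
    rw [e]
    exact hasSum_zero
  have hL := hasSum_SLam_KInv_hessFF Lc hLc κ' u α β
  have h := ((hW.mul_left cE).add (hB.mul_left cVH)).add (hL.mul_left cΛ)
  simp only [mul_zero, add_zero] at h
  refine h.congr_fun fun xz => ?_
  simp only [S0, Pi.add_apply, Pi.smul_apply, smul_eq_mul]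

/-- [folklore] **THE FIELD–FIELD BLOCK OF THE COMPOSITE FINE STENCIL `Sc n κ u` HAS ZERO DOUBLE-LEG SUM, AT EVERY LEVEL `n`** (all `d`,
`Lc ≥ 1`, all `cE cVH cΛ`, every fine bond `(κ, u)` and directions `α, β`):
`HasSum ((x, z) ↦ Sc d Lc cE cVH cΛ n κ u x z (inl α) (inl β)) 0`. -/
theorem hasSum_Sc_inl_inl (hLc : 1 ≤ Lc) (cE cVH cΛ : ℝ) :
    ∀ (n : ℕ) (κ : Fin (d + 1)) (u : Site (d + 1)) (α β : Fin (d + 1)),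
      HasSum (fun xz : Site (d + 1) × Site (d + 1) => Sc d Lc cE cVH cΛ n κ u xz.1 xz.2 (Sum.inl α) (Sum.inl β)) 0
  | 0, κ, u, α, β => by
      simp only [Sc_zero]
      exact hasSum_S0_inl_inl hLc cE cVH cΛ κ u α β
  | n + 1, κ, u, α, β => by
      have hIH := hasSum_Sc_inl_inl hLc cE cVH cΛ n κ u α β
      have hP : HasSum (fun xz : Site (d + 1) × Site (d + 1) =>
          pushSum (Lc ^ (n + 1)) Lc (Sc d Lc cE cVH cΛ n κ u) xz.1 xz.2 (Sum.inl α) (Sum.inl β)) 0 :=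
        hIH.congr_fun fun xz => pushSum_inl_inl _ _ _ _ _ _ _
      have hB : HasSum (fun xz : Site (d + 1) × Site (d + 1) => borderInc d Lc (Lc ^ (n + 1)) κ u xz.1 xz.2 (Sum.inl α) (Sum.inl β)) 0 := by
        have e : (fun xz : Site (d + 1) × Site (d + 1) => borderInc d Lc (Lc ^ (n + 1)) κ u xz.1 xz.2 (Sum.inl α) (Sum.inl β))
            = fun _ => 0 := funext fun xz => borderInc_inl_inl Lc _ κ u xz.1 xz.2 α β
        rw [e]
        exact hasSum_zero
      have hL := hasSum_lagrInc_inl_inl (d := d) Lc (Lc ^ (n + 1)) (Lc ^ (n + 2)) hLc (pow_succ Lc (n + 1)) κ u α β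
      have h := ((hP.mul_left ((Lc : ℝ) ^ (d + 1))).add (hB.mul_left (cVH * ((Lc : ℝ) ^ (n + 1)) ^ (d + 2)))).add
        (hL.mul_left (cΛ * ((Lc : ℝ) ^ (n + 1)) ^ (2 * d + 4)))
      simp only [mul_zero, add_zero] at h
      refine h.congr_fun fun xz => ?_
      rw [Sc_succ]
      simp only [Pi.add_apply, Pi.smul_apply, smul_eq_mul]

/-- [folklore] The double-leg sum in `tsum` form. -/
theorem tsum_Sc_inl_inl (hLc : 1 ≤ Lc) (cE cVH cΛ : ℝ) (n : ℕ) (κ : Fin (d + 1)) (u : Site (d + 1)) (α β : Fin (d + 1)) :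
    ∑' xz : Site (d + 1) × Site (d + 1), Sc d Lc cE cVH cΛ n κ u xz.1 xz.2 (Sum.inl α) (Sum.inl β) = 0 :=
  (hasSum_Sc_inl_inl hLc cE cVH cΛ n κ u α β).tsum_eq

/-- [folklore] The double-leg sum in ITERATED form: `Σ'_x Σ'_z Sc … n κ u x z (inl α) (inl β) = 0`. -/
theorem tsum_tsum_Sc_inl_inl (hLc : 1 ≤ Lc) (cE cVH cΛ : ℝ) (n : ℕ) (κ : Fin (d + 1)) (u : Site (d + 1)) (α β : Fin (d + 1)) :
    ∑' x, ∑' z, Sc d Lc cE cVH cΛ n κ u x z (Sum.inl α) (Sum.inl β) = 0 := by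
  obtain ⟨Cs, δ, hδ, hS⟩ := locStencil_Sc (d := d) (Lc := Lc) hLc cE cVH cΛ n
  rw [← tsum_prod_eq_tsum_tsum_of_biLoc (hS κ u) hδ]
  exact tsum_Sc_inl_inl hLc cE cVH cΛ n κ u α β

end Main

/-! ## §8 The chain-rule vertex of a stencil family with zero field–field totals has zero field–field totals -/

section Vertex

variable {N : ℕ} [NeZero N]

/-- [folklore] **`vertexOf S μ y` INHERITS ZERO FIELD–FIELD TOTALS FROM `S`**: the chain-rule vertex is the superposition
`Σ_{κ′} Σ'_u wH κ′ μ (u − N•y) · S κ′ u` with exponentially decaying weights (`decay_wH`) of kernels bi-localised at their own bond. -/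
theorem hasSum_vertexOf_inl_inl {S : Fin (d + 1) → Site (d + 1) → MKer (d + 1) (Fib d)} {Cs δ : ℝ} (hS : LocStencil S Cs δ)
    (hδ : 0 < δ) {α β : Fin (d + 1)}
    (h0 : ∀ κ' u, ∑' xz : Site (d + 1) × Site (d + 1), S κ' u xz.1 xz.2 (Sum.inl α) (Sum.inl β) = 0)
    (μ : Fin (d + 1)) (y : Site (d + 1)) :
    HasSum (fun xz : Site (d + 1) × Site (d + 1) => vertexOf (N := N) S μ y xz.1 xz.2 (Sum.inl α) (Sum.inl β)) 0 := by
  obtain ⟨δw, Cw, hδw, hwH⟩ := decay_wH (N := N) (d := d)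
  have hκ : ∀ κ' : Fin (d + 1), HasSum (fun xz : Site (d + 1) × Site (d + 1) =>
      wsum (fun u => wH (N := N) κ' μ (u - (N : ℤ) • y)) (S κ') xz.1 xz.2 (Sum.inl α) (Sum.inl β)) 0 := by
    intro κ'
    have hw : ∀ u : Site (d + 1), |wH (N := N) κ' μ (u - (N : ℤ) • y)| ≤ Cw * Real.exp (-δw * l1 (((1 : ℕ) : ℤ) • u - (N : ℤ) • y)) :=
      fun u => by rw [Nat.cast_one, one_smul]; exact hwH κ' μ _
    have hQ : ∀ u : Site (d + 1), BiLoc (S κ' u) (((1 : ℕ) : ℤ) • u) (((1 : ℕ) : ℤ) • u) Cs δ := fun u => by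
      rw [Nat.cast_one, one_smul]; exact hS κ' u
    have h := hasSum_prod_wsum_of_kernels le_rfl hw hδw hQ hδ (Sum.inl α) (Sum.inl β) (h0 κ')
    refine h.congr_fun fun xz => ?_
    simp only [wsum]
  have h := hasSum_sum fun κ' (_ : κ' ∈ (Finset.univ : Finset (Fin (d + 1)))) => hκ κ'
  simp only [Finset.sum_const_zero] at h
  refine h.congr_fun fun xz => ?_
  simp only [vertexOf]

variable {Lc : ℕ} [NeZero Lc]

/-- [folklore] **COROLLARY**: the chain-rule vertex of the level-`n` composite stencil family, at ANY blocking `N`, has zero field–field totals. -/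
theorem hasSum_vertexOf_Sc_inl_inl (hLc : 1 ≤ Lc) (cE cVH cΛ : ℝ) (n : ℕ) (μ : Fin (d + 1)) (y : Site (d + 1)) (α β : Fin (d + 1)) :
    HasSum (fun xz : Site (d + 1) × Site (d + 1) =>
      vertexOf (N := N) (Sc d Lc cE cVH cΛ n) μ y xz.1 xz.2 (Sum.inl α) (Sum.inl β)) 0 := by
  obtain ⟨Cs, δ, hδ, hS⟩ := locStencil_Sc (d := d) (Lc := Lc) hLc cE cVH cΛ n
  exact hasSum_vertexOf_inl_inl hS hδ (fun κ' u => tsum_Sc_inl_inl hLc cE cVH cΛ n κ' u α β) μ y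

end Vertex

end Summit.QuantumFields.BalabanUV.Beta.GAN24.CompositeStencilChargeZero

end
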